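import Literature.Geometry.Lorentzian.PositiveMassRigidity
import HarnessLib

/-!
# The positive mass theorem (Schoen–Yau 1979, Thm. 1): the architecture of the printed proof

`PositiveMassRigidity.lean` vendors Schoen–Yau's positive mass theorem in their expansion form as
the named fact `Literature.Geometry.Lorentzian.schoenYau_mass_nonneg` (Comm. Math. Phys. 65
(1979), Thm. 1, p. 48: *"Let `ds²` be an asymptotically flat metric on an oriented `3`-manifold
`N`. If `R ≥ 0` on `N`, then the total mass of each end is nonnegative"*, for a boundaryless,
connected `X` with one end `e` on which (1.1) `h = (1 + M/2r)⁴ δ + O₂(r⁻²)` holds,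
`IsAsymptoticallySchwarzschild e D M 2`). The printed proof (§2, pp. 48–63, with the Appendix,
pp. 74–75) is a research programme of its own — geometric measure theory for the Plateau problem,
curvature estimates for minimal surfaces, the second variation / Gauss–Bonnet argument on a
complete non-compact minimal surface — none of which Mathlib or the tree has. This file records
the architecture of §2 and proves the assembly of Theorem 1 from its steps
(`schoenYau_mass_nonneg_of_steps`).

Schoen–Yau, p. 48: *"We will suppose that `M < 0` and `R ≥ 0` in contradiction to Theorem 1. The
proof then involves three steps, the first allowing us to assume `R > 0` outside a compact subset
of `ℝ³ ∖ B_{σ₀}(0)`, the second is to use the assumption `M < 0` to prove the existence of a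
complete area minimizing surface, and third to use second variation arguments to show that this
is impossible if `R ≥ 0`."*

1. `exists_conformal_scalarPos_of_massNeg` — **Step 1** (pp. 48–49), a named fact, verbatim:
   *"If `ds²` is asymptotically flat on `N` with `R ≥ 0`, and with the total mass of `N_k`
   negative, then there is an asymptotically flat metric `d̃s²` conformally equivalent to `ds²`
   having `R̃ ≥ 0` on `N`, `R̃ > 0` outside a compact subset of `N_k`, and having negative total
   mass for `N_k`."* (Proof: by (1.1), `Δ(1/r) = M r⁻⁴ + O(r⁻⁵) < 0` for `r ≥ σ` ((2.1)); with a
   `C⁵` profile `ζ`, `ζ(t) = t` for `t ≤ t₀`, `ζ` constant for `t ≥ 2t₀`, `ζ' ≥ 0`, `ζ'' ≤ 0`,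
   the function `φ = 1 + ζ(-M/4r)` on `N_k`, constant elsewhere, satisfies `Δφ ≤ 0` on `N` and
   `Δφ < 0` for `r > 2σ` ((2.2)–(2.3)); `d̃s² = φ⁴ ds²` has scalar curvature `R̃ = φ⁻⁵(Rφ - 8Δφ)`,
   again the expansion (1.1), and total mass `M̃ = M/2 < 0`.) It is *discharged* downstream
   (`exists_conformal_scalarPos_of_massNeg_holds`, `SuperharmonicFactor.lean`).
2. **Steps 2 and 3** together (pp. 49–63), i.e. Theorem 1 under the additional hypothesis
   delivered by Step 1 (*"so that we are assuming `R ≥ 0` on `N`, `R > 0` outside a compact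
   subset of `N_k`, and `M < 0`"*, p. 49, followed by *"Step 2. There exists a complete area
   minimizing (relative to `ds²`) surface `S` properly imbedded in `N` so that `S ∩ (N ∖ N_k)` is
   compact, and `S ∩ N_k` lies between two parallel Euclidean `2`-planes in the `3`-space
   defined by `x¹, x², x³`"* and *"Step 3. The surface `S` constructed in Step 2 cannot exist"*,
   p. 52). This half is **not a named fact**: it is a slice of the printed proof of Thm. 1 — the
   theorem itself under one extra hypothesis, with no statement or locator of its own in the
   source — and of the size of the theorem (the decomposition was reviewed under D-0026 and the
   former fact `schoenYau_mass_nonneg_of_scalarPos_far` merged back into the obligation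
   `schoenYau_mass_nonneg`). It is carried *written out* as the hypothesis `h₂₃` of the assembly
   theorems: on boundaryless, connected, oriented, one-ended data whose end is asymptotically
   Schwarzschildean of mass `M` to second order ((1.1)), with `R ≥ 0` everywhere and `R > 0` on
   a far region `e.far ρ` of the end (`N_k` is `ℝ³ ∖ B_{σ₀}(0)` with the *open* ball
   `B_{σ₀}(0) = {|x| < σ₀}`, p. 48, so "outside a compact subset of `N_k`" is "for `r > ρ`",
   which is what Step 1 delivers ((2.3)) and (2.18) uses), `0 ≤ M`. The two steps are not
   separated either: their common interface is a complete, properly embedded surface which is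
   *area minimizing among all compactly supported competitors regardless of topological type*
   (the Plateau solutions `S_σ` of the Appendix are minimizing integral currents, Federer 5.1.6,
   regular by §5.3–5.4 of Federer's book), and Step 3 uses that minimizing property against
   spherical domains ((2.9): `Area(S ∩ B_σ) ≤ C₂ σ²`), against least-Euclidean-area surfaces of
   arbitrary type ((2.22)–(2.25)) and against annulus-and-cylinder competitors ((2.28)); the
   tree has no currents, no area of non-smooth competitors and no Plateau problem, so a faithful
   Lean interface for "area minimizing" is not available, and a Step 3 stated for merely
   *stable* surfaces would claim more than the source proves. The architecture, for the record:
   Step 2 — Plateau solutions `S_σ` spanning the coordinate circles `C_σ ⊆ {x³ = 0}`;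
   confinement away from the other ends by the convexity of `|y|²` ((2.4)); the height bound
   `S_σ ∩ N_k ⊆ {|x³| ≤ h}` from the Hessian of `x³` ((2.6)–(2.7)), which is where `M < 0`
   enters (the slabs `{|x³| ≤ h}` are mean convex); local area bounds ((2.8)); the
   curvature/regularity estimate (2.1) (Schoen–Simon–Yau, Acta Math. 134 (1975)); a diagonal
   limit `S_{σᵢ} → S`. Step 3 — quadratic area growth ((2.9)–(2.11)); the second variation
   inequality `∫_S (Ric(ν,ν) + ‖A‖²) f² ≤ ∫_S ‖∇f‖²` ((2.13)) and the Gauss equation ((2.14)) give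
   `∫_S (R/2 - K + ‖A‖²/2) f² ≤ ∫_S ‖∇f‖²` ((2.15)); logarithmic cut-offs give `∫_S ‖A‖² < ∞`
   ((2.16)), `∫_S |K| < ∞` ((2.17)) and `0 < ½ ∫_S (R + ‖A‖²) ≤ ∫_S K` ((2.18), strict because
   `R > 0` far out on the non-compact `S`); Cohn-Vossen's inequality makes `S ≅ ℝ²` (Remark 2.1);
   and the Claim `∫_S K ≤ 0` (two proofs: Huber's theorem and the Finn–Huber formula
   `∫_S K = 2π - lim Lᵢ²/2Aᵢ` with an isoperimetric comparison, (2.19)–(2.25); or Gauss–Bonnet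
   with boundary on the discs `D_σ = S ∩ {r' ≤ σ}` with `∫_{∂D_σ} k ≥ 2π - o(1)`, (2.26)–(2.42))
   is the contradiction.
3. `schoenYau_mass_nonneg_of_steps` — **proved**: Step 1 and Steps 2–3 imply
   `schoenYau_mass_nonneg` (if `M < 0`, Step 1 produces data on the same oriented one-ended
   manifold to which Steps 2–3 apply, giving `0 ≤ M̃ < 0`).

Consequently the rigidity DAG of `PositiveMassRigidity.lean` has the leaves: Step 1, Steps 2–3
(equivalently, given Step 1, Thm. 1 itself), Cor. 3.1, the Ricci variation (3.24)–(3.30),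
completeness of one-ended data and Greene–Wu's Thm. A (`positive_mass_rigidity_of_steps`).

## Design

* Step 1 and the hypothesis `h₂₃` quantify over the data exactly like `schoenYau_mass_nonneg`
  (universe-`0` manifold `X`, `D : InitialDataSet (𝓡 3) X` with the standing instance
  `[D.metric.HasLeviCivita]`, an end `e : AFEnd X`, the mass parameter `M : ℝ` of (1.1)), so
  that the assembly is pure logic, and carry the standing hypotheses of Schoen–Yau's §1
  (oriented; one end, `e.IsSoleEnd`, which is their compact `K` with `N ∖ K` the end) even where
  the printed step does not use them (Step 1 uses neither): extra hypotheses keep a fact true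
  and no stronger than its source.
* Step 1 is stated in the shape of `exists_conformal_negativeMass_of_massZero` (Cor. 3.1 in
  `PositiveMassRigidity.lean`): the conformal metric is packaged as data `D'` on the same `X`
  with `h' = φ⁴ h` pointwise and its own Levi-Civita instance (no burden on a discharge: every
  smooth metric has one, `PseudoRiemannianMetric.hasLeviCivita`), asymptotically
  Schwarzschildean for the *same* end structure `e` with some mass `M' < 0` (the source gives
  `M' = M/2`; only negativity is consumed).
* "`R > 0` outside a compact subset of `N_k`" is vendored in the form Step 1 delivers and Step 3
  consumes ((2.3): `Δφ < 0`, hence `R̃ > 0`, for `r > 2σ`): `R > 0` on a far region `e.far ρ` of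
  the end.
* `h₂₃` is a proper special case of `schoenYau_mass_nonneg` (one hypothesis more), so the
  theorems taking it are no stronger than "Thm. 1 implies …"; the unproved published result they
  rest on is Thm. 1.

## References

* R. Schoen, S.-T. Yau, *On the proof of the positive mass conjecture in general relativity*,
  Comm. Math. Phys. 65 (1979) 45–76: §1 (1.1), Thm. 1 (p. 48); §2, Step 1 (pp. 48–49,
  (2.1)–(2.3)), Step 2 (pp. 49–52, (2.4)–(2.8)), Step 3 (pp. 52–63, (2.9)–(2.42), Remark 2.1);
  Appendix (pp. 74–75).
* H. Federer, *Geometric measure theory*, Springer 1969, 5.1.6, §5.3, Thm. 5.4.15 (as cited in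
  the Appendix of Schoen–Yau).
* R. Schoen, L. Simon, S.-T. Yau, *Curvature estimates for minimal hypersurfaces*, Acta Math. 134
  (1975) 275–288 (the Regularity Estimate (2.1)).
-/

noncomputable section

open Bundle Set Manifold TopologicalSpace Filter Asymptotics Module
open scoped ContDiff Topology Manifold

namespace Literature.Geometry.Lorentzian

/-! ### Step 1: conformal perturbation to positive scalar curvature far out -/

/-- **Schoen–Yau 1979, §2, Step 1** (pp. 48–49), verbatim: *"If `ds²` is asymptotically flat on
`N` with `R ≥ 0`, and with the total mass of `N_k` negative, then there is an asymptotically flat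
metric `d̃s²` conformally equivalent to `ds²` having `R̃ ≥ 0` on `N`, `R̃ > 0` outside a compact
subset of `N_k`, and having negative total mass for `N_k`."* (Proof, (2.1)–(2.3): `Δ(1/r) =
M r⁻⁴ + O(r⁻⁵) < 0` for `r ≥ σ`; `φ = 1 + ζ(-M/4r)` on `N_k` with a concave nondecreasing `C⁵`
profile `ζ`, linear below `t₀ = -M/8σ` and constant above `2t₀`, `φ` constant off `N_k`; then
`Δφ ≤ 0` on `N`, `Δφ < 0` for `r > 2σ`, and `d̃s² = φ⁴ ds²` has `R̃ = φ⁻⁵(Rφ - 8Δφ)`, the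
expansion (1.1) with total mass `M̃ = M/2 < 0`.) Hypotheses (the standing ones of §1 included):
`X` oriented; the end `e` asymptotically Schwarzschildean of mass `M` to second order ((1.1),
`IsAsymptoticallySchwarzschild e D M 2`); `e` the only end; `R(h) ≥ 0`; `M < 0`. Conclusion:
there are a positive function `φ` and data `D'` on `X` with metric `h' = φ⁴ h` pointwise (a
smooth Riemannian metric admitting the Levi-Civita API) such that `e` is asymptotically
Schwarzschildean for `h'` with some mass `M' < 0` ((1.1)), `R(h') ≥ 0` on `X`, and `R(h') > 0`
on a far region `e.far ρ` of the end ((2.3), the form in which "outside a compact subset of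
`N_k`" is produced and used). By Thm. 1 the hypotheses are never met; the non-vacuous content
through which a faithful discharge goes is the superharmonic conformal factor (2.1)–(2.3) and
the conformal transformation law of scalar curvature.
[cite: SchoenYauPMT1979, §2 Step 1 (pp. 48–49)] -/
def exists_conformal_scalarPos_of_massNeg : Prop :=
  ∀ (X : Type) [TopologicalSpace X] [ChartedSpace E3 X] [IsManifold (𝓡 3) ∞ X] [T2Space X]
    [SecondCountableTopology X] [ConnectedSpace X]
    (D : InitialDataSet (𝓡 3) X) [D.metric.HasLeviCivita] (e : AFEnd X) (M : ℝ),
    Literature.Topology.FourManifolds.IsOrientable (𝓡 3) X → IsAsymptoticallySchwarzschild e D M 2 →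
    e.IsSoleEnd → (∀ x : X, 0 ≤ D.metric.scalarCurvature x) → M < 0 →
    ∃ (φ : X → ℝ) (D' : InitialDataSet (𝓡 3) X) (_ : D'.metric.HasLeviCivita) (M' ρ : ℝ),
      (∀ x : X, 0 < φ x) ∧
      (∀ (x : X) (v w : TangentSpace (𝓡 3) x),
        D'.metric.val x v w = φ x ^ 4 * D.metric.val x v w) ∧
      IsAsymptoticallySchwarzschild e D' M' 2 ∧ M' < 0 ∧
      (∀ x : X, 0 ≤ D'.metric.scalarCurvature x) ∧
      ∀ x ∈ e.far ρ, 0 < D'.metric.scalarCurvature x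

/-! ### Assembly: Theorem 1 from Step 1 and Steps 2–3 -/

/-- **Theorem 1 from Steps 1–3**, exactly as printed (Schoen–Yau 1979, p. 48: "We will suppose
that `M < 0` and `R ≥ 0` in contradiction to Theorem 1. The proof then involves three steps"):
if `M < 0`, Step 1 (`h₁`) yields conformal data on the same oriented one-ended manifold,
asymptotically Schwarzschildean of negative mass with `R ≥ 0` everywhere and `R > 0` on a far
region, which Steps 2–3 exclude. **Steps 2 and 3** (pp. 49–63) are the written-out hypothesis
`h₂₃` — Theorem 1 under the additional hypothesis delivered by Step 1, verbatim (p. 49 and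
p. 52): *"so that we are assuming `R ≥ 0` on `N`, `R > 0` outside a compact subset of `N_k`, and
`M < 0`. Step 2. There exists a complete area minimizing (relative to `ds²`) surface `S` properly
imbedded in `N` so that `S ∩ (N ∖ N_k)` is compact, and `S ∩ N_k` lies between two parallel
Euclidean `2`-planes in the `3`-space defined by `x¹, x², x³`. … Step 3. The surface `S`
constructed in Step 2 cannot exist."* Step 2 (pp. 49–52): Plateau solutions `S_σ` of least area
among all surfaces bounded by the coordinate circles `C_σ` (Appendix: Federer 5.1.6, §5.3,
5.4.15), kept in a fixed compact set off the end ((2.4)) and in a slab `{|x³| ≤ h}` on the end by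
the maximum principle for `x³|S_σ` ((2.5)–(2.7), where `M < 0` enters), with local area bounds
((2.8)) and the curvature estimate (2.1), converge along `σᵢ → ∞` to `S`. Step 3 (pp. 52–63):
`Area(S ∩ B_σ) ≤ C₂σ²` ((2.9)); stability `∫_S (Ric(ν,ν) + ‖A‖²) f² ≤ ∫_S ‖∇f‖²` ((2.13)) with
the Gauss equation ((2.14)–(2.15)) and logarithmic cut-offs gives `∫_S ‖A‖² < ∞`, `∫_S |K| < ∞`
((2.16)–(2.17)) and `0 < ½ ∫_S (R + ‖A‖²) ≤ ∫_S K` ((2.18)); `S ≅ ℝ²` by Cohn-Vossen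
(Remark 2.1); and `∫_S K ≤ 0` (Claim, pp. 55–63: via Huber's theorem and the Finn–Huber formula
(2.19) with the isoperimetric comparison (2.20)–(2.25), or via Gauss–Bonnet on the discs `D_σ`
with `∫_{∂D_σ} k ≥ 2π - o(1)`, (2.26)–(2.42)) — a contradiction. Hypotheses of `h₂₃`: `X`
oriented; `e` asymptotically Schwarzschildean of mass `M` to second order ((1.1)); `e` the only
end (`N ∖ N_k` compact); `R(h) ≥ 0` on `X`; `R(h) > 0` on some far region `e.far ρ` ((2.3); `N_k`
is `ℝ³ ∖ B_{σ₀}(0)` with the *open* ball `B_{σ₀}(0) = {|x| < σ₀}`, p. 48, so "outside a compact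
subset of `N_k`" is "for `r > ρ`", which is what Step 1 delivers and (2.18) uses); conclusion
`0 ≤ M`. (A slice of the printed proof of Thm. 1, of the size of the theorem, hence not a named
fact; the published result it is part of is `schoenYau_mass_nonneg`.)
[cite: SchoenYauPMT1979, Thm. 1 (p. 48) and §2] -/
theorem schoenYau_mass_nonneg_of_steps (h₁ : exists_conformal_scalarPos_of_massNeg)
    (h₂₃ : ∀ (X : Type) [TopologicalSpace X] [ChartedSpace E3 X] [IsManifold (𝓡 3) ∞ X]
      [T2Space X] [SecondCountableTopology X] [ConnectedSpace X]
      (D : InitialDataSet (𝓡 3) X) [D.metric.HasLeviCivita] (e : AFEnd X) (M : ℝ),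
      Literature.Topology.FourManifolds.IsOrientable (𝓡 3) X →
      IsAsymptoticallySchwarzschild e D M 2 → e.IsSoleEnd →
      (∀ x : X, 0 ≤ D.metric.scalarCurvature x) →
      (∃ ρ : ℝ, ∀ x ∈ e.far ρ, 0 < D.metric.scalarCurvature x) → 0 ≤ M) :
    schoenYau_mass_nonneg := by
  intro X _ _ _ _ _ _ D _ e M hor hAS hsole hR
  by_contra hM
  push Not at hM
  obtain ⟨φ, D', hL, M', ρ, -, -, hAS', hM', hR', hpos⟩ := h₁ X D e M hor hAS hsole hR hM
  have h0M' : 0 ≤ M' := h₂₃ X D' e M' hor hAS' hsole hR' ⟨ρ, hpos⟩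
  exact absurd hM' (not_lt.2 h0M')

/-- **The rigidity DAG with Theorem 1 unfolded into its steps**: `positive_mass_rigidity`
(Schoen–Yau 1979, Thm. 2) follows from Step 1 (`h₁`) and Steps 2–3 (the written-out hypothesis
`h₂₃`, as in `schoenYau_mass_nonneg_of_steps`) of the proof of Thm. 1, Cor. 3.1, the Ricci
variation (3.24)–(3.30), completeness of one-ended asymptotically flat data and Greene–Wu's
Thm. A (`positive_mass_rigidity_of_source_facts'''` with `schoenYau_mass_nonneg_of_steps`).
[cite: SchoenYauPMT1979, Thms. 1–2 (p. 48), §2 and §3] -/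
theorem positive_mass_rigidity_of_steps (h₁ : exists_conformal_scalarPos_of_massNeg)
    (h₂₃ : ∀ (X : Type) [TopologicalSpace X] [ChartedSpace E3 X] [IsManifold (𝓡 3) ∞ X]
      [T2Space X] [SecondCountableTopology X] [ConnectedSpace X]
      (D : InitialDataSet (𝓡 3) X) [D.metric.HasLeviCivita] (e : AFEnd X) (M : ℝ),
      Literature.Topology.FourManifolds.IsOrientable (𝓡 3) X →
      IsAsymptoticallySchwarzschild e D M 2 → e.IsSoleEnd →
      (∀ x : X, 0 ≤ D.metric.scalarCurvature x) →
      (∃ ρ : ℝ, ∀ x ∈ e.far ρ, 0 < D.metric.scalarCurvature x) → 0 ≤ M)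
    (hc : exists_conformal_negativeMass_of_massZero)
    (hv : exists_ricciVariation_negativeMass_of_massZero)
    (h₄ : isComplete_of_isSoleEnd) (h₅ : euclidean_of_isFlat_of_isSoleEnd) :
    positive_mass_rigidity :=
  positive_mass_rigidity_of_source_facts''' (schoenYau_mass_nonneg_of_steps h₁ h₂₃) hc hv h₄ h₅

end Literature.Geometry.Lorentzian

end
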